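import Literature.AnabelianGeometry.AbsoluteAnabelian.MonoidKummerMapsTLGLiftForcesContinuity
import Literature.AnabelianGeometry.AbsoluteAnabelian.MonoidKummerMapsMonoAnalyticLiftHolds
import HarnessLib

/-!
# [AbsTopIII] Prop 3.2 (iv) / Prop 3.3 (ii) AS TYPED: the lifting sentences are EQUIVALENT to the
# continuity of abstract isomorphisms of absolute Galois groups of MLFs (abc-iut FACT-LIST F-0412 and the
# all-`H` closures of F-0409 / F-0413 pinned to ONE classical sentence)

Proof-only companion (theorems only, no new definitions) of abc-iut-L4-t2's `MonoidKummerMaps.lean`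
(S. Mochizuki, *Topics in Absolute Anabelian Geometry III*, Def. 3.1 (i)/(ii) pp. 66–68, Prop. 3.2 (iv)
p. 72, Prop. 3.3 (ii) p. 74; kurims manuscript, lit key `paper:url-5493eb38cbb7`), abc-iut cell seat
abc-iut-f-103 (F tranche 103); sequel of abc-iut-L6-t13's `MonoidKummerMapsTLGLiftForcesContinuity.lean`.

STATE OF THE ROWS.  abc-iut-L6-d1 reduced every surjectivity sentence of `MonoidKummerMaps.lean` to
(BA_abs) = «every ABSTRACT group isomorphism `α : Gal(k̄₁/k₁) ⥲ Gal(k̄₂/k₂)` of absolute Galois groups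
of MLFs admits an `α`-equivariant `β : k̄₁^× ⥲ k̄₂^×»; abc-iut-L6-t13 PROVED the topological form (BA)
(`biAnabelianUnits_holds`, local class field theory), closed (BA_abs) − (BA) MODULO the Nikolov–Segal
theorem BY NAME (F-1977, `MonoidKummerMapsTLGLiftOfFiniteIndexOpen.lean`), and proved that F-0412
`UnitPairIsoFibres` FORCES the continuity of abstract `α` (`MonoidKummerMapsTLGLiftForcesContinuity.lean`:
the discrete model pairs of Def. 3.1 (i) as typed).  THIS FILE packages the picture as EQUIVALENCES with
the single classical sentence

  (CONT) every abstract group isomorphism between absolute Galois groups of MLFs (arbitrary algebraic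
         closures, Krull topologies) is continuous,

and extends it to the `TM` row:

* `MLFClosure.exists_discreteModel` — (public form of the discrete model) Def. 3.1 (i) AS TYPED admits
  `Π_k := G_k` with the DISCRETE topology and `ε_k = id` (continuous, bijective, not open);
* `ModelMLFGaloisData.tlgPairIso_equivariant` — an isomorphism of model `TLG`-pairs whose Galois
  component covers the abstract `α` through bijective augmentations has an `α`-equivariant monoid part;
* `continuous_galoisMulEquiv_of_tlgLifting` — the `TLG` lifting sentence ⇒ (CONT);
  `continuous_galoisMulEquiv_of_forall_galoisIsoLiftsToTMPairIso` — the all-`H` closure of F-0409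
  (`TM`) ⇒ (CONT), through abc-iut-L6-t21's extension of `TM`-isomorphisms to fractions;
* `biAnabelianUnits_abstract_of_forall_continuous`, `tlgLifting_of_forall_continuous` — (CONT) ⇒
  (BA_abs) ⇒ the `TLG` lifting sentence (over the tree theorem (BA));
* the EQUIVALENCES `unitPairIsoFibres_iff_forall_continuous` (F-0412 ⟺ (CONT)),
  `forall_galoisIsoLiftsToTMPairIso_iff_forall_continuous` ((∀ H, F-0409 H) ⟺ (CONT)),
  `forall_unitPairIsoFibresOfType_iff_forall_continuous` ((∀ H, F-0413 H) ⟺ (CONT)).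

WHAT THIS SAYS ABOUT THE TYPING (no side taken; a faithfulness observation for the referees): print's
`Isom_{𝒯𝒢}(Π, Π*)` (Def. 3.1 (iii) p. 68, with Def. 3.1 (ii) p. 67 "induces an open injective
homomorphism between the respective arithmetic Galois groups") consists of isomorphisms whose induced
map of arithmetic Galois groups is a homeomorphism; the typing (audit A21-F3) kept the kernel condition
only, and the typed model data allow non-quotient augmentations — so the typed rows equal print's
statements PLUS (CONT), a sentence of Nikolov–Segal type, while the print-faithful instances (compact
`Π`, or `α` continuous) are tree theorems (`tlgLifting_compact_holds`, `biAnabelianUnits_holds`).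
HONEST FRAMING: OUR kernel check of equivalences between statements of refereed papers and a classical
continuity statement; nothing here bears on [IUTchIII] Cor. 3.12 or asserts anything about abc; a FACT
row is an assumption label, not an endorsement.

## References

* S. Mochizuki, *Topics in Absolute Anabelian Geometry III*, Def. 3.1, Prop. 3.2 (iv), Prop. 3.3 (ii).
  [MochizukiAbsTopIII2015]
* S. Mochizuki, *Comments on [AbsTopIII]* (2019), item (5). [MochizukiAbsTopIIIComments2019]
-/

noncomputable section

open scoped nonZeroDivisors Topology

namespace Literature.AnabelianGeometry.AbsoluteAnabelian

/-! ### §1. The discrete model of Def. 3.1 (i) -/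

/-- **Def. 3.1 (i) as typed admits the DISCRETE model**: for every MLF with algebraic closure there is
model data `(Π_k, ε_k)` with `Π_k = G_k` carrying the discrete topology and `ε_k` the identity — a
continuous bijective surjection onto `G_k` with its Krull topology (the typed `ModelMLFGaloisData`
asks for no more). [cite: MochizukiAbsTopIII2015, Definition 3.1 (i) p.66] -/
theorem MLFClosure.exists_discreteModel (C : MLFClosure.{0}) :
    ∃ D : ModelMLFGaloisData C.k C.K, DiscreteTopology D.Pi ∧ Function.Bijective D.aug :=
  ⟨@ModelMLFGaloisData.mk C.k _ C.K _ _ (C.K ≃ₐ[C.k] C.K) _ ⊥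
      (@topologicalGroup_of_discreteTopology _ ⊥ _ (@DiscreteTopology.mk _ ⊥ rfl)) (MonoidHom.id _)
      continuous_bot (fun σ => ⟨σ, rfl⟩),
    @DiscreteTopology.mk _ ⊥ rfl, Function.bijective_id⟩

/-! ### §2. An isomorphism of model `TLG`-pairs over an abstract `α` is `α`-equivariant -/

section Model

variable {C₁ C₂ : MLFClosure.{0}} (D₁ : ModelMLFGaloisData C₁.k C₁.K) (D₂ : ModelMLFGaloisData C₂.k C₂.K)

/-- **Equivariance transport.**  If an isomorphism `e` of the model `TLG`-pairs has Galois component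
covering the abstract `α` (`ε₂ ∘ e_Π = α ∘ ε₁`) and `ε₁` is bijective, then its monoid component
`β = e_M : k̄₁^× ⥲ k̄₂^×` is `α`-equivariant in the sense of (BA): `β (σ x) = α(σ) (β x)`.
[cite: MochizukiAbsTopIII2015, Definition 3.1 (ii) p.67] -/
theorem ModelMLFGaloisData.tlgPairIso_equivariant (hb₁ : Function.Bijective D₁.aug)
    (α : (C₁.K ≃ₐ[C₁.k] C₁.K) ≃* (C₂.K ≃ₐ[C₂.k] C₂.K)) (e : GaloisMonoidPair.Iso D₁.tlgPair D₂.tlgPair)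
    (hα : ∀ g, D₂.aug (e.isoPi g) = α (D₁.aug g)) (σ : C₁.K ≃ₐ[C₁.k] C₁.K) (x y : D₁.tlgPair.M)
    (hxy : ((y : (C₁.K)⁰) : C₁.K) = σ ((x : (C₁.K)⁰) : C₁.K)) :
    ((e.isoM y : (C₂.K)⁰) : C₂.K) = α σ ((e.isoM x : (C₂.K)⁰) : C₂.K) := by
  obtain ⟨g, rfl⟩ : ∃ g : D₁.tlgPair.Pi, D₁.aug g = σ := hb₁.2 σ
  have hy : y = g • x := Subtype.ext (by
    show ((y : (C₁.K)⁰) : C₁.K) = D₁.aug g • ((x : (C₁.K)⁰) : C₁.K)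
    rw [AlgEquiv.smul_def]
    exact hxy)
  rw [hy, e.smul_comm g x]
  show D₂.aug (e.isoPi g) • ((e.isoM x : (C₂.K)⁰) : C₂.K) = _
  rw [hα, AlgEquiv.smul_def]

end Model

/-! ### §3. The lifting sentences force (CONT) -/

/-- **The `TLG` lifting sentence AS TYPED implies (CONT)** — every abstract isomorphism of absolute
Galois groups of MLFs is continuous (abc-iut-L6-t13's `biAnabelianUnits_abstract_of_tlgLifting` and
`continuous_galoisMulEquiv_of_equivariant`, composed). [cite: MochizukiAbsTopIII2015, Proposition 3.3 (ii) p.74] -/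
theorem continuous_galoisMulEquiv_of_tlgLifting
    (hL : ∀ (P Q : GaloisMonoidPair.{0}), IsMLFGaloisMonoidPair .TLG P → IsMLFGaloisMonoidPair .TLG Q →
      ∀ f : P.Pi ≃ₜ* Q.Pi, P.actionKer.map f.toMulEquiv.toMonoidHom = Q.actionKer →
        ∃ e : GaloisMonoidPair.Iso P Q, e.isoPi = f)
    (C₁ C₂ : MLFClosure.{0}) (α : (C₁.K ≃ₐ[C₁.k] C₁.K) ≃* (C₂.K ≃ₐ[C₂.k] C₂.K)) : Continuous α := by
  obtain ⟨β, hβ⟩ := biAnabelianUnits_abstract_of_tlgLifting hL C₁ C₂ α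
  exact continuous_galoisMulEquiv_of_equivariant C₁ C₂ α β hβ

/-- **F-0409 (all `H`) ⇒ (CONT)**: if `GaloisIsoLiftsToTMPairIso H` holds for EVERY hypothesis predicate
`H` (equivalently for `H := ⊤`), then every abstract isomorphism of absolute Galois groups of MLFs is
continuous — apply it to the DISCRETE model `TM`-pairs (`MLFClosure.exists_discreteModel`), between
which `α`, transported along the bijective augmentations, is an admissible `Π₁ ⥲ Π₂` (trivial
arithmetic kernels); the resulting `TM`-isomorphism extends to fractions (abc-iut-L6-t21's
`ModelMLFGaloisData.exists_tlgPair_iso_of_tmPair_iso`), is `α`-equivariant (§2), and abc-iut-L6-t13's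
`continuous_galoisMulEquiv_of_equivariant` applies. [cite: MochizukiAbsTopIII2015, Proposition 3.2 (iv) p.72] -/
theorem continuous_galoisMulEquiv_of_forall_galoisIsoLiftsToTMPairIso
    (h : ∀ H : GaloisMonoidPair.{0} → Prop, GaloisIsoLiftsToTMPairIso H) (C₁ C₂ : MLFClosure.{0})
    (α : (C₁.K ≃ₐ[C₁.k] C₁.K) ≃* (C₂.K ≃ₐ[C₂.k] C₂.K)) : Continuous α := by
  obtain ⟨D₁, hd₁, hb₁⟩ := C₁.exists_discreteModel
  obtain ⟨D₂, hd₂, hb₂⟩ := C₂.exists_discreteModel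
  let a₁ : D₁.Pi ≃* (C₁.K ≃ₐ[C₁.k] C₁.K) := MulEquiv.ofBijective D₁.aug hb₁
  let a₂ : D₂.Pi ≃* (C₂.K ≃ₐ[C₂.k] C₂.K) := MulEquiv.ofBijective D₂.aug hb₂
  let f₀ : D₁.Pi ≃* D₂.Pi := a₁.trans (α.trans a₂.symm)
  let f : D₁.Pi ≃ₜ* D₂.Pi :=
    { f₀ with
      continuous_toFun := continuous_of_discreteTopology
      continuous_invFun := continuous_of_discreteTopology }
  have hfα : ∀ g, D₂.aug (f g) = α (D₁.aug g) := fun g => by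
    show a₂ (a₂.symm (α (a₁ g))) = α (D₁.aug g)
    rw [MulEquiv.apply_symm_apply]
    rfl
  have hker : D₁.tmPair.actionKer.map f.toMulEquiv.toMonoidHom = D₂.tmPair.actionKer := by
    rw [ModelMLFGaloisData.tmPair_actionKer C₁ D₁, ModelMLFGaloisData.tmPair_actionKer C₂ D₂,
      (MonoidHom.ker_eq_bot_iff D₁.aug).2 hb₁.1, (MonoidHom.ker_eq_bot_iff D₂.aug).2 hb₂.1,
      Subgroup.map_bot]
  obtain ⟨e, he⟩ := h (fun _ => True) D₁.tmPair D₂.tmPair (isMLFGaloisMonoidPair_tmPair C₁ D₁)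
    (isMLFGaloisMonoidPair_tmPair C₂ D₂) trivial trivial f hker
  obtain ⟨e', he'⟩ := ModelMLFGaloisData.exists_tlgPair_iso_of_tmPair_iso D₁ D₂ e
  exact continuous_galoisMulEquiv_of_equivariant C₁ C₂ α e'.isoM
    (D₁.tlgPairIso_equivariant D₂ hb₁ α e' fun g => by rw [he', he]; exact hfα g)

/-! ### §4. Conversely: continuity of abstract isomorphisms suffices (over (BA), a tree theorem) -/

/-- **Continuity ⇒ (BA_abs)**: if every abstract isomorphism of absolute Galois groups of MLFs is
continuous, then every such `α` admits an `α`-equivariant `β : k̄₁^× ⥲ k̄₂^×` — by abc-iut-L6-t13's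
`biAnabelianUnits_holds` (local class field theory) applied to `α` made topological.
[cite: MochizukiAbsTopIII2015, Proposition 3.2 (iv) p.72] -/
theorem biAnabelianUnits_abstract_of_forall_continuous
    (hc : ∀ (C₁ C₂ : MLFClosure.{0}) (α : (C₁.K ≃ₐ[C₁.k] C₁.K) ≃* (C₂.K ≃ₐ[C₂.k] C₂.K)), Continuous α)
    (C₁ C₂ : MLFClosure.{0}) (α : (C₁.K ≃ₐ[C₁.k] C₁.K) ≃* (C₂.K ≃ₐ[C₂.k] C₂.K)) :
    ∃ β : (C₁.K)⁰ ≃* (C₂.K)⁰, ∀ (σ : C₁.K ≃ₐ[C₁.k] C₁.K) (x y : (C₁.K)⁰), (y : C₁.K) = σ x →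
      ((β y : (C₂.K)⁰) : C₂.K) = α σ ((β x : (C₂.K)⁰) : C₂.K) :=
  biAnabelianUnits_holds C₁ C₂
    { α with
      continuous_toFun := hc C₁ C₂ α
      continuous_invFun := hc C₂ C₁ α.symm }

/-- **Continuity ⇒ the `TLG` lifting sentence** (all MLF-Galois `TLG`-pairs, all admissible `Π ⥲ Π*`),
via abc-iut-L6-d1's `tlgLifting_of_biAnabelianUnits_abstract`.
[cite: MochizukiAbsTopIII2015, Proposition 3.3 (ii) p.74] -/
theorem tlgLifting_of_forall_continuous
    (hc : ∀ (C₁ C₂ : MLFClosure.{0}) (α : (C₁.K ≃ₐ[C₁.k] C₁.K) ≃* (C₂.K ≃ₐ[C₂.k] C₂.K)), Continuous α)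
    (P Q : GaloisMonoidPair.{0}) (hP : IsMLFGaloisMonoidPair .TLG P) (hQ : IsMLFGaloisMonoidPair .TLG Q)
    (f : P.Pi ≃ₜ* Q.Pi) (hf : P.actionKer.map f.toMulEquiv.toMonoidHom = Q.actionKer) :
    ∃ e : GaloisMonoidPair.Iso P Q, e.isoPi = f :=
  tlgLifting_of_biAnabelianUnits_abstract (biAnabelianUnits_abstract_of_forall_continuous hc)
    P Q hP hQ f hf

/-! ### §5. The equivalences (F-0412; all-`H` closures of F-0409, F-0413) -/

/-- **F-0412 pinned.**  The named fact `UnitPairIsoFibres` ([AbsTopIII] Prop 3.3 (ii) AS TYPED) holds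
IF AND ONLY IF every abstract group isomorphism between absolute Galois groups of MLFs (arbitrary
algebraic closures) is continuous for the Krull topologies.  (⇐ is print's proposition, a tree
theorem over local class field theory; ⇒ is the surplus of the typing.)
[cite: MochizukiAbsTopIII2015, Proposition 3.3 (ii) p.74] [cite: MochizukiAbsTopIIIComments2019, item (5)] -/
theorem unitPairIsoFibres_iff_forall_continuous :
    Literature.AnabelianGeometry.AbsoluteAnabelian.UnitPairIsoFibres ↔
      ∀ (C₁ C₂ : MLFClosure.{0}) (α : (C₁.K ≃ₐ[C₁.k] C₁.K) ≃* (C₂.K ≃ₐ[C₂.k] C₂.K)), Continuous α :=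
  ⟨continuous_galoisMulEquiv_of_unitPairIsoFibres,
    fun hc => unitPairIsoFibres_iff_exists_lift.2 (tlgLifting_of_forall_continuous hc)⟩

/-- **F-0409, all-`H` closure, pinned.**  `GaloisIsoLiftsToTMPairIso H` for EVERY hypothesis predicate
`H` ([AbsTopIII] Prop 3.2 (iv) as typed, the corrected "hyperbolic orbicurve type" binder ranging over
all predicates) IF AND ONLY IF every abstract isomorphism of absolute Galois groups of MLFs is
continuous. [cite: MochizukiAbsTopIII2015, Proposition 3.2 (iv) p.72] [cite: MochizukiAbsTopIIIComments2019, item (5)] -/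
theorem forall_galoisIsoLiftsToTMPairIso_iff_forall_continuous :
    (∀ H : GaloisMonoidPair.{0} → Prop,
        Literature.AnabelianGeometry.AbsoluteAnabelian.GaloisIsoLiftsToTMPairIso H) ↔
      ∀ (C₁ C₂ : MLFClosure.{0}) (α : (C₁.K ≃ₐ[C₁.k] C₁.K) ≃* (C₂.K ≃ₐ[C₂.k] C₂.K)), Continuous α :=
  ⟨continuous_galoisMulEquiv_of_forall_galoisIsoLiftsToTMPairIso,
    fun hc H => galoisIsoLiftsToTMPairIso_of_biAnabelianUnits_abstract
      (biAnabelianUnits_abstract_of_forall_continuous hc) H⟩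

/-- **F-0413, all-`H` closure, pinned.**  `UnitPairIsoFibresOfType H` for EVERY hypothesis predicate `H`
([AbsTopIII] Prop 3.3 (ii) as corrected and typed) IF AND ONLY IF every abstract isomorphism of absolute
Galois groups of MLFs is continuous (⇒ through the `TLG` clause at `H := ⊤`, which is the `TLG`
lifting sentence; ⇐ abc-iut-L6-d1's `unitPairIsoFibresOfType_of_biAnabelianUnits_abstract`).
[cite: MochizukiAbsTopIII2015, Proposition 3.3 (ii) p.74] [cite: MochizukiAbsTopIIIComments2019, item (5)] -/
theorem forall_unitPairIsoFibresOfType_iff_forall_continuous :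
    (∀ H : GaloisMonoidPair.{0} → Prop,
        Literature.AnabelianGeometry.AbsoluteAnabelian.UnitPairIsoFibresOfType H) ↔
      ∀ (C₁ C₂ : MLFClosure.{0}) (α : (C₁.K ≃ₐ[C₁.k] C₁.K) ≃* (C₂.K ≃ₐ[C₂.k] C₂.K)), Continuous α := by
  refine ⟨fun h => continuous_galoisMulEquiv_of_tlgLifting fun P Q hP hQ f hf => ?_,
    fun hc H => unitPairIsoFibresOfType_of_biAnabelianUnits_abstract
      (biAnabelianUnits_abstract_of_forall_continuous hc) H⟩
  obtain ⟨e₁, -, he₁, -⟩ := (h fun _ => True).2 P Q hP hQ trivial trivial f hf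
  exact ⟨e₁, he₁⟩

end Literature.AnabelianGeometry.AbsoluteAnabelian

end
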